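import Literature.Algebra.Homology.ClassModule
import Mathlib.Topology.Instances.AddCircle.Defs
import HarnessLib

/-!
# The invariant maps `inv_U : H²(U, A) ⥲ (1/|U|)ℤ/ℤ` of a class module, at every subgroup, and the
# axiom `inv_U ∘ res = [G : U] · inv_G` (Serre, *Local Fields* XI §2–§3; Neukirch, *Bonn Lectures* II §1)

Topic `Algebra/Homology`; namespace `Literature.Algebra.Homology` (dot-definitions on the tree's
`IsClassModule`, Lang III §3).  Definitions with bodies (`AddMonoidHom.liftOfGenerator`, a homomorphism out of
a monogenic abelian group prescribed on the generator; `IsClassModule.inv`, `IsClassModule.invSub`) and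
theorems; no named fact, no instance, no `sorry`.  Sequel of `ClassModule.lean` (`IsClassModule A φ`:
`H²(U, A) = ℤ · res_U α` with `res_U α` of order `|U|`, `addOrderOf_H2π`, `addOrderOf_map_subtype`).

THE POINT.  For a class module `(A, α = [φ])` over `ℤ` with finite group `G` (one finite layer of a class
formation), the group `H²(U, Res_U A)` is cyclic of order `|U|` generated by `res_U α` for every subgroup
`U ≤ G`.  Hence there is a unique **invariant map**

  `inv_U : H²(U, A) →+ ℚ/ℤ`, `inv_U (res_U α) = 1/|U|`  (`IsClassModule.invSub`; `inv_G = IsClassModule.inv`),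

injective with image `(1/|U|)ℤ/ℤ` (Serre XI §3: in a class formation the fundamental class `u_{E′/E}` is THE
class with `inv_{E′}… = 1/[E′:E]`; Neukirch II (1.6) b) `res_L u_{N|K} = u_{N|L}`), and the axiom of class
formations relating two levels holds: **`inv_U (res_U x) = [G : U] · inv_G (x)`** (`invSub_map_subtype`;
Serre XI §2 Prop. 1 / Neukirch II (1.4) b): `inv_L ∘ res_L = [L:K] · inv_K`).  Everything is elementary
(orders of generators); `ℚ/ℤ` is Mathlib's `AddCircle (1 : ℚ)` and `1/|U|` the class of the rational `1/|U|`.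

Written for Route A of the Poitou–Tate programme of crux `stmt-BirchSwinnertonDyer-19295` (cell
`bsd-schneider-ideate`, seat door-c4 gen 16): applied to the idèle class layers `(Gal(E/F), C_E)` (door-c4 g11:
class modules) and their subgroups `H_E = Gal(E/L)` (door-c6 g15's relative layers), it yields the invariant
maps `inv_U` at every open subgroup `U = Gal(F̄/L) ≤ Γ_F` on `H²(U, C̄) = lim→ H²(H_E, C_E)` and the `Res`-axiom
`inv_U ∘ res = [Γ_F : U] · inv_F`, i.e. the field `invAt_bijective` of door-c4's Tate duality theorem.
HONEST FRAMING: homological algebra only; no arithmetic statement and no case of BSD is proved here.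

## References
* J.-P. Serre, *Local Fields*, GTM 67 (1979), XI §2 Proposition 1 and §3 (class formations: `inv`, the
  fundamental class, `inv_{E′} ∘ Res = [E′:E] · inv_E`). [Serre1979]
* J. Neukirch, *Class Field Theory – The Bonn Lectures* (2013), II §1 (1.3)–(1.6)
  (`inv_L ∘ res_L = [L:K] · inv_K`, `res_L u_{N|K} = u_{N|L}`). [Neukirch2013]
* S. Lang, *Topics in Cohomology of Groups*, LNM 1625 (1996), III §3 (class modules). [Lang1996]
-/

noncomputable section

open CategoryTheory CategoryTheory.Limits groupCohomology

namespace Literature.Algebra.Homology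

/-! ## §1 Homomorphisms out of a monogenic abelian group -/

section Generator

variable {H : Type*} [AddCommGroup H] {Q : Type*} [AddCommGroup Q]

/-- Two multiples of a generator agree iff the coefficients differ by a multiple of its order.
[cite: Lang1996, III §3] -/
theorem zsmul_eq_zsmul_iff_addOrderOf_dvd_sub (g : H) (r r' : ℤ) :
    r • g = r' • g ↔ (addOrderOf g : ℤ) ∣ r - r' := by
  rw [addOrderOf_dvd_iff_zsmul_eq_zero, sub_zsmul, ← sub_eq_add_neg, sub_eq_zero]

/-- If `r • g = r' • g` then `r • t = r' • t` for every `t` killed by the order of `g`.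
[cite: Lang1996, III §3] -/
theorem zsmul_eq_zsmul_of_generator (g : H) (t : Q) (ht : addOrderOf g • t = 0) {r r' : ℤ}
    (h : r • g = r' • g) : r • t = r' • t := by
  obtain ⟨m, hm⟩ := (zsmul_eq_zsmul_iff_addOrderOf_dvd_sub g r r').1 h
  have h0 : (r - r') • t = 0 := by
    rw [hm, mul_comm, mul_zsmul, natCast_zsmul, ht, zsmul_zero]
  rwa [sub_zsmul, ← sub_eq_add_neg, sub_eq_zero] at h0

/-- The chosen coefficient of an element of a monogenic group (auxiliary).
[cite: Lang1996, III §3] -/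
theorem exists_coeff (g : H) (hg : ∀ x : H, ∃ r : ℤ, r • g = x) (x : H) : ∃ r : ℤ, r • g = x := hg x

/-- **The additive homomorphism out of the monogenic group `H = ℤ · g` sending `g ↦ t`**, for any `t`
killed by the order of `g` (`r • g ↦ r • t`, well defined by `zsmul_eq_zsmul_of_generator`).
[cite: Lang1996, III §3][cite: Serre1979, XI §3] -/
def AddMonoidHom.liftOfGenerator (g : H) (hg : ∀ x : H, ∃ r : ℤ, r • g = x) (t : Q)
    (ht : addOrderOf g • t = 0) : H →+ Q :=
  AddMonoidHom.mk' (fun x => (exists_coeff g hg x).choose • t) fun x y => by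
    rw [← add_zsmul]
    refine zsmul_eq_zsmul_of_generator g t ht ?_
    rw [add_zsmul, (exists_coeff g hg x).choose_spec, (exists_coeff g hg y).choose_spec,
      (exists_coeff g hg (x + y)).choose_spec]

/-- **`liftOfGenerator g t (r • g) = r • t`.** [cite: Lang1996, III §3] -/
theorem AddMonoidHom.liftOfGenerator_zsmul (g : H) (hg : ∀ x : H, ∃ r : ℤ, r • g = x) (t : Q)
    (ht : addOrderOf g • t = 0) (r : ℤ) :
    AddMonoidHom.liftOfGenerator g hg t ht (r • g) = r • t := by
  rw [AddMonoidHom.liftOfGenerator, AddMonoidHom.mk'_apply]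
  exact zsmul_eq_zsmul_of_generator g t ht (exists_coeff g hg (r • g)).choose_spec

/-- **`liftOfGenerator g t g = t`.** [cite: Lang1996, III §3] -/
theorem AddMonoidHom.liftOfGenerator_self (g : H) (hg : ∀ x : H, ∃ r : ℤ, r • g = x) (t : Q)
    (ht : addOrderOf g • t = 0) : AddMonoidHom.liftOfGenerator g hg t ht g = t := by
  have h := AddMonoidHom.liftOfGenerator_zsmul g hg t ht 1
  rwa [one_zsmul, one_zsmul] at h

/-- **Uniqueness**: two homomorphisms out of `ℤ · g` agreeing on `g` are equal. [cite: Lang1996, III §3] -/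
theorem AddMonoidHom.ext_of_generator (g : H) (hg : ∀ x : H, ∃ r : ℤ, r • g = x) {f f' : H →+ Q}
    (h : f g = f' g) : f = f' := by
  refine AddMonoidHom.ext fun x => ?_
  obtain ⟨r, rfl⟩ := hg x
  rw [map_zsmul, map_zsmul, h]

/-- A homomorphism out of `ℤ · g` with `f g = t` is `liftOfGenerator g t`. [cite: Lang1996, III §3] -/
theorem AddMonoidHom.eq_liftOfGenerator (g : H) (hg : ∀ x : H, ∃ r : ℤ, r • g = x) (t : Q)
    (ht : addOrderOf g • t = 0) (f : H →+ Q) (hf : f g = t) : f = AddMonoidHom.liftOfGenerator g hg t ht :=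
  AddMonoidHom.ext_of_generator g hg (hf.trans (AddMonoidHom.liftOfGenerator_self g hg t ht).symm)

/-- **Injectivity**: if `r • t = 0` forces `addOrderOf g ∣ r` (i.e. `t` has the same order as `g`), then
`liftOfGenerator g t` is injective. [cite: Serre1979, XI §3] -/
theorem AddMonoidHom.liftOfGenerator_injective (g : H) (hg : ∀ x : H, ∃ r : ℤ, r • g = x) (t : Q)
    (ht : addOrderOf g • t = 0) (hord : ∀ r : ℤ, r • t = 0 → (addOrderOf g : ℤ) ∣ r) :
    Function.Injective (AddMonoidHom.liftOfGenerator g hg t ht) := by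
  refine (injective_iff_map_eq_zero _).2 fun x hx => ?_
  obtain ⟨r, rfl⟩ := hg x
  rw [AddMonoidHom.liftOfGenerator_zsmul] at hx
  exact addOrderOf_dvd_iff_zsmul_eq_zero.1 (hord r hx)

/-- The image of `liftOfGenerator g t` is `ℤ · t`. [cite: Serre1979, XI §3] -/
theorem AddMonoidHom.range_liftOfGenerator (g : H) (hg : ∀ x : H, ∃ r : ℤ, r • g = x) (t : Q)
    (ht : addOrderOf g • t = 0) :
    Set.range (AddMonoidHom.liftOfGenerator g hg t ht) = Set.range fun r : ℤ => r • t := by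
  ext q
  constructor
  · rintro ⟨x, rfl⟩
    obtain ⟨r, rfl⟩ := hg x
    exact ⟨r, (AddMonoidHom.liftOfGenerator_zsmul g hg t ht r).symm⟩
  · rintro ⟨r, rfl⟩
    exact ⟨r • g, AddMonoidHom.liftOfGenerator_zsmul g hg t ht r⟩

end Generator

/-! ## §2 The values `1/n ∈ ℚ/ℤ` -/

section Values

/-- **`1/n ∈ ℚ/ℤ`** (`ℚ/ℤ = AddCircle (1 : ℚ)`), the prescribed invariant of a fundamental class of a group of
order `n`. [cite: Serre1979, XI §3] -/
def oneDiv (n : ℕ) : AddCircle (1 : ℚ) := (((1 : ℚ) / n : ℚ) : AddCircle (1 : ℚ))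

/-- `r • (1/n) = r/n` in `ℚ/ℤ`. [cite: Serre1979, XI §3] -/
theorem zsmul_oneDiv (n : ℕ) (r : ℤ) : r • oneDiv n = (((r : ℚ) / n : ℚ) : AddCircle (1 : ℚ)) := by
  rw [oneDiv, ← AddCircle.coe_zsmul, zsmul_eq_mul, mul_one_div]

/-- `n • (1/n) = 0` in `ℚ/ℤ`. [cite: Serre1979, XI §3] -/
theorem nsmul_oneDiv (n : ℕ) : n • oneDiv n = 0 := by
  rcases Nat.eq_zero_or_pos n with rfl | hn
  · rw [zero_nsmul]
  · rw [← natCast_zsmul, zsmul_oneDiv, Int.cast_natCast, div_self (Nat.cast_ne_zero.2 hn.ne'),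
      AddCircle.coe_period]

/-- **`r • (1/n) = 0` in `ℚ/ℤ` iff `n ∣ r`** (`n ≥ 1`). [cite: Serre1979, XI §3] -/
theorem zsmul_oneDiv_eq_zero_iff {n : ℕ} (hn : 0 < n) (r : ℤ) : r • oneDiv n = 0 ↔ (n : ℤ) ∣ r := by
  have hn' : (n : ℚ) ≠ 0 := Nat.cast_ne_zero.2 hn.ne'
  rw [zsmul_oneDiv, AddCircle.coe_eq_zero_iff]
  constructor
  · rintro ⟨m, hm⟩
    rw [zsmul_eq_mul, mul_one] at hm
    refine ⟨m, ?_⟩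
    have h1 : (r : ℚ) = m * n := (div_eq_iff hn').1 hm.symm
    have h2 : (r : ℚ) = ((n * m : ℤ) : ℚ) := by rw [h1, Int.cast_mul, Int.cast_natCast, mul_comm]
    exact_mod_cast h2
  · rintro ⟨m, rfl⟩
    refine ⟨m, ?_⟩
    rw [zsmul_eq_mul, mul_one, Int.cast_mul, Int.cast_natCast, mul_div_cancel_left₀ _ hn']

/-- **`m • (1/(m·n)) = 1/n`** in `ℚ/ℤ` (`m ≥ 1`): the compatibility of the prescribed invariants of two levels
`|G| = [G:U] · |U|`. [cite: Serre1979, XI §2 Proposition 1][cite: Neukirch2013, II §1 Prop. (1.4) b)] -/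
theorem nsmul_oneDiv_mul {m : ℕ} (hm : 0 < m) (n : ℕ) : m • oneDiv (m * n) = oneDiv n := by
  rw [← natCast_zsmul, zsmul_oneDiv, oneDiv, Int.cast_natCast, Nat.cast_mul,
    ← div_div, div_self (Nat.cast_ne_zero.2 hm.ne')]

/-- `(1/n) ∈ ℚ/ℤ` has order dividing `n`; for `n ≥ 1` its order is `n`. [cite: Serre1979, XI §3] -/
theorem addOrderOf_oneDiv {n : ℕ} (hn : 0 < n) : addOrderOf (oneDiv n) = n := by
  refine Nat.dvd_antisymm (addOrderOf_dvd_of_nsmul_eq_zero (nsmul_oneDiv n)) ?_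
  have h := addOrderOf_nsmul_eq_zero (oneDiv n)
  rw [← natCast_zsmul, zsmul_oneDiv_eq_zero_iff hn] at h
  exact Int.natCast_dvd_natCast.1 h

end Values

/-! ## §3 The invariant maps of a class module -/

section ClassModule

variable {G : Type} [Group G] [Finite G] {A : Rep.{0} ℤ G} {φ : cocycles₂ A}

/-- Over `ℤ`, Mathlib's module action of `r : ℤ` on `Hⁿ(G, A)` is the `r`-fold multiple (the two `ℤ`-module
structures on an additive group coincide). [folklore] -/
private theorem moduleCat_smul_eq_zsmul' (X : ModuleCat.{0} ℤ) (r : ℤ) (x : X) : X.isModule.smul r x = r • x :=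
  int_smul_eq_zsmul X.isModule r x

omit [Finite G] in
/-- **`H²(U, A) = ℤ · res_U α`** for a class module (every class is an INTEGER multiple of `res_U α`).
[cite: Lang1996, III §3 (definition before Thm. 3.2)] -/
theorem IsClassModule.exists_zsmul_map_subtype_H2π_eq (hA : IsClassModule A φ) (U : Subgroup G)
    (x : groupCohomology (Rep.res U.subtype A) 2) :
    ∃ r : ℤ, r • map U.subtype (𝟙 (Rep.res U.subtype A)) 2 (H2π A φ) = x := by
  obtain ⟨r, hr⟩ := hA.exists_smul_eq U x
  exact ⟨r, (moduleCat_smul_eq_zsmul' _ r _).symm.trans hr⟩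

omit [Finite G] in
/-- **`H²(G, A) = ℤ · α`** for a class module (through the injective `res_⊤`).
[cite: Lang1996, III §3 (definition before Thm. 3.2)][cite: Neukirch2013, I §7 Thm. (7.3)] -/
theorem IsClassModule.exists_zsmul_H2π_eq (hA : IsClassModule A φ) (x : groupCohomology A 2) :
    ∃ r : ℤ, r • H2π A φ = x := by
  obtain ⟨r, hr⟩ := hA.exists_zsmul_map_subtype_H2π_eq ⊤
    (map (⊤ : Subgroup G).subtype (𝟙 (Rep.res (⊤ : Subgroup G).subtype A)) 2 x)
  refine ⟨r, res_injective_of_isUnit_index (⊤ : Subgroup G) A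
    (by rw [Subgroup.index_top, Nat.cast_one]; exact isUnit_one) 2 ?_⟩
  change (map (⊤ : Subgroup G).subtype (𝟙 (Rep.res (⊤ : Subgroup G).subtype A)) 2).hom (r • H2π A φ) = _
  rw [map_zsmul]
  exact hr

/-- **THE invariant map `inv_G : H²(G, A) →+ ℚ/ℤ` of a class module**, `inv_G (α) = 1/|G|`.
[cite: Serre1979, XI §3][cite: Neukirch2013, II §1 (1.3)] -/
def IsClassModule.inv (hA : IsClassModule A φ) : groupCohomology A 2 →+ AddCircle (1 : ℚ) :=
  AddMonoidHom.liftOfGenerator (H2π A φ) hA.exists_zsmul_H2π_eq (oneDiv (Nat.card G))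
    (by rw [hA.addOrderOf_H2π]; exact nsmul_oneDiv _)

/-- **`inv_G (α) = 1/|G|`.** [cite: Serre1979, XI §3][cite: Neukirch2013, II §1 (1.3)] -/
theorem IsClassModule.inv_H2π (hA : IsClassModule A φ) : hA.inv (H2π A φ) = oneDiv (Nat.card G) :=
  AddMonoidHom.liftOfGenerator_self _ _ _ _

/-- `inv_G (r • α) = r/|G|`. [cite: Serre1979, XI §3] -/
theorem IsClassModule.inv_zsmul_H2π (hA : IsClassModule A φ) (r : ℤ) :
    hA.inv (r • H2π A φ) = r • oneDiv (Nat.card G) :=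
  AddMonoidHom.liftOfGenerator_zsmul _ _ _ _ r

/-- **`inv_G` is injective.** [cite: Serre1979, XI §3][cite: Neukirch2013, II §1 (1.3)] -/
theorem IsClassModule.inv_injective (hA : IsClassModule A φ) : Function.Injective hA.inv :=
  AddMonoidHom.liftOfGenerator_injective _ _ _ _ fun r hr => by
    rw [hA.addOrderOf_H2π]
    exact (zsmul_oneDiv_eq_zero_iff Nat.card_pos r).1 hr

/-- The image of `inv_G` is `(1/|G|)ℤ/ℤ = ℤ · (1/|G|)`. [cite: Serre1979, XI §3] -/
theorem IsClassModule.range_inv (hA : IsClassModule A φ) :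
    Set.range hA.inv = Set.range fun r : ℤ => r • oneDiv (Nat.card G) :=
  AddMonoidHom.range_liftOfGenerator _ _ _ _

/-- **Uniqueness of `inv_G`**: an additive map `H²(G, A) → ℚ/ℤ` with value `1/|G|` on the fundamental class is
`inv_G`. [cite: Serre1979, XI §3] -/
theorem IsClassModule.eq_inv_of_apply_H2π (hA : IsClassModule A φ) (f : groupCohomology A 2 →+ AddCircle (1 : ℚ))
    (hf : f (H2π A φ) = oneDiv (Nat.card G)) : f = hA.inv :=
  AddMonoidHom.eq_liftOfGenerator _ _ _ _ f hf

/-- **The invariant map `inv_U : H²(U, A) →+ ℚ/ℤ` at a subgroup `U`**, `inv_U (res_U α) = 1/|U|`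
(`res_U α` is the fundamental class of the class module `Res_U A`).
[cite: Serre1979, XI §3][cite: Neukirch2013, II §1 Prop. (1.6) b)] -/
def IsClassModule.invSub (hA : IsClassModule A φ) (U : Subgroup G) :
    groupCohomology (Rep.res U.subtype A) 2 →+ AddCircle (1 : ℚ) :=
  AddMonoidHom.liftOfGenerator (map U.subtype (𝟙 (Rep.res U.subtype A)) 2 (H2π A φ))
    (hA.exists_zsmul_map_subtype_H2π_eq U) (oneDiv (Nat.card U))
    (by rw [hA.addOrderOf_map_subtype U]; exact nsmul_oneDiv _)

/-- **`inv_U (res_U α) = 1/|U|`.** [cite: Serre1979, XI §3][cite: Neukirch2013, II §1 Prop. (1.6) b)] -/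
theorem IsClassModule.invSub_map_subtype_H2π (hA : IsClassModule A φ) (U : Subgroup G) :
    hA.invSub U (map U.subtype (𝟙 (Rep.res U.subtype A)) 2 (H2π A φ)) = oneDiv (Nat.card U) :=
  AddMonoidHom.liftOfGenerator_self _ _ _ _

/-- `inv_U (r • res_U α) = r/|U|`. [cite: Serre1979, XI §3] -/
theorem IsClassModule.invSub_zsmul (hA : IsClassModule A φ) (U : Subgroup G) (r : ℤ) :
    hA.invSub U (r • map U.subtype (𝟙 (Rep.res U.subtype A)) 2 (H2π A φ)) = r • oneDiv (Nat.card U) :=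
  AddMonoidHom.liftOfGenerator_zsmul _ _ _ _ r

/-- **`inv_U` is injective.** [cite: Serre1979, XI §2 Proposition 1][cite: Neukirch2013, II §1 (1.3)] -/
theorem IsClassModule.invSub_injective (hA : IsClassModule A φ) (U : Subgroup G) :
    Function.Injective (hA.invSub U) :=
  AddMonoidHom.liftOfGenerator_injective _ _ _ _ fun r hr => by
    rw [hA.addOrderOf_map_subtype U]
    exact (zsmul_oneDiv_eq_zero_iff Nat.card_pos r).1 hr

/-- The image of `inv_U` is `(1/|U|)ℤ/ℤ`. [cite: Serre1979, XI §3] -/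
theorem IsClassModule.range_invSub (hA : IsClassModule A φ) (U : Subgroup G) :
    Set.range (hA.invSub U) = Set.range fun r : ℤ => r • oneDiv (Nat.card U) :=
  AddMonoidHom.range_liftOfGenerator _ _ _ _

/-- **Uniqueness of `inv_U`.** [cite: Serre1979, XI §3] -/
theorem IsClassModule.eq_invSub_of_apply (hA : IsClassModule A φ) (U : Subgroup G)
    (f : groupCohomology (Rep.res U.subtype A) 2 →+ AddCircle (1 : ℚ))
    (hf : f (map U.subtype (𝟙 (Rep.res U.subtype A)) 2 (H2π A φ)) = oneDiv (Nat.card U)) : f = hA.invSub U :=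
  AddMonoidHom.eq_liftOfGenerator _ _ _ _ f hf

/-- The invariant of a subgroup depends on the fundamental class only through `res_U α` (two class-module
structures with the same restricted class have the same `inv_U`). [cite: Serre1979, XI §3] -/
theorem IsClassModule.invSub_congr (hA : IsClassModule A φ) {φ' : cocycles₂ A} (hA' : IsClassModule A φ')
    (U : Subgroup G)
    (h : map U.subtype (𝟙 (Rep.res U.subtype A)) 2 (H2π A φ) = map U.subtype (𝟙 (Rep.res U.subtype A)) 2 (H2π A φ')) :
    hA.invSub U = hA'.invSub U :=
  hA'.eq_invSub_of_apply U _ (by rw [← h]; exact hA.invSub_map_subtype_H2π U)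

/-- **The axiom `inv_U ∘ res_U = [G : U] · inv_G`** (Serre XI §2 Prop. 1 / Neukirch II (1.4) b)):
`res_U (r · α) = r · res_U α` has invariant `r/|U| = [G:U] · (r/|G|)`.
[cite: Serre1979, XI §2 Proposition 1][cite: Neukirch2013, II §1 Prop. (1.4) b)] -/
theorem IsClassModule.invSub_map_subtype (hA : IsClassModule A φ) (U : Subgroup G) (x : groupCohomology A 2) :
    hA.invSub U (map U.subtype (𝟙 (Rep.res U.subtype A)) 2 x) = U.index • hA.inv x := by
  obtain ⟨r, rfl⟩ := hA.exists_zsmul_H2π_eq x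
  have hmap : (map U.subtype (𝟙 (Rep.res U.subtype A)) 2) (r • H2π A φ) =
      r • map U.subtype (𝟙 (Rep.res U.subtype A)) 2 (H2π A φ) :=
    map_zsmul (map U.subtype (𝟙 (Rep.res U.subtype A)) 2).hom r _
  rw [hmap, hA.invSub_zsmul, hA.inv_zsmul_H2π, smul_comm, ← U.index_mul_card,
    nsmul_oneDiv_mul (Nat.pos_of_ne_zero Subgroup.FiniteIndex.index_ne_zero)]

/-- The same as an identity of homomorphisms: `inv_U ∘ res_U = [G : U] • inv_G`.
[cite: Serre1979, XI §2 Proposition 1][cite: Neukirch2013, II §1 Prop. (1.4) b)] -/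
theorem IsClassModule.invSub_comp_map_subtype (hA : IsClassModule A φ) (U : Subgroup G) :
    (hA.invSub U).comp (map U.subtype (𝟙 (Rep.res U.subtype A)) 2).hom.toAddMonoidHom = U.index • hA.inv :=
  AddMonoidHom.ext fun x => hA.invSub_map_subtype U x

/-- **Surjectivity of the restriction on `H²`, read through the invariants**: every value `r/|U|` is the
invariant of a RESTRICTED class `res_U (r · α)`. [cite: Serre1979, XI §2 Proposition 1 (i)] -/
theorem IsClassModule.exists_invSub_map_subtype_eq (hA : IsClassModule A φ) (U : Subgroup G) (r : ℤ) :
    ∃ x : groupCohomology A 2, hA.invSub U (map U.subtype (𝟙 (Rep.res U.subtype A)) 2 x) =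
      r • oneDiv (Nat.card U) := by
  refine ⟨r • H2π A φ, ?_⟩
  have hmap : (map U.subtype (𝟙 (Rep.res U.subtype A)) 2) (r • H2π A φ) =
      r • map U.subtype (𝟙 (Rep.res U.subtype A)) 2 (H2π A φ) :=
    map_zsmul (map U.subtype (𝟙 (Rep.res U.subtype A)) 2).hom r _
  rw [hmap, hA.invSub_zsmul]

end ClassModule

end Literature.Algebra.Homology

end
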